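import Mathlib
import HarnessLib
import Summits.HubbardSuperconductivity.HubbardSuperconductivity.Theorems.KLProgrammeKLRegimeVolumeLimitLastScaleDualDoor

/-!
# Route `KLProgramme` — crux K3, VL child `KLRegimeVolumeLimitV17F2` (stmt-HubbardSuperconductivity-20440): the dual row defect from the PINNED
# position-space two-leg defect (phases dropped, times summed) — the most primitive target shape for ROUTE A's (A3)
# (cell gate-hubbard-kl, seat hubbard-kl-k3c5-p3 g9, technique «OS-positivity-free direct assembly»)

`…VolumeLimitLastScaleDualDoor` closes the VL stub text from «`2ε·(Ddef₊ + Dfar₊) ≤ δ L`», `Ddef₊`/`Dfar₊` the phase-weighted ROW defect / far rows of the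
position-space two-leg kernels `W_V = sectorisedKernel β (trivialMultiplier) G_V 2 ((0,σ,+),(0,σ,−))`, `G_V = 𝒱_V[K_V] − 𝒩_{K_V}`.  Dropping the unimodular Matsubara
phases and summing the second leg's time FIRST gives the plain PINNED TWO-LEG DEFECT at one pair of pins with the second legs matched through the centred lift
of the OFFSET — the shape in which a two-volume pass delivers (k3c5-p2's `Def_w`, k3c4-p1's transfer theorem at the deepest pin):

* §1 `dualRows_le_pinnedDefect` — for any `Gc`, `Gf`, pins `o_c`, `o_f`, label, spin:
  `Ddef₊ + Dfar₊ ≤ Σ_{t₁} Σ_{x̄} ‖W_c(o_c,(t₁,o⃗_c+x̄)) − W_f(o_f,(t₁,o⃗_f+x̄↑))‖ + Σ_{t₁} Σ_{y ≠ (red y)↑} ‖W_f(o_f,(t₁,o⃗_f+y))‖` =: `PDef + PFar`;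
* §2 **`framedNestedFlowTextV17F2_of_lastScaleDualPinnedText`** — the stub text from «∃ pins, `2ε·(PDef + PFar) ≤ δ L` eventually per label» (last scale, own flow
  frames, σ = 0); `volumeLimitTextV17F2_of_lastScaleDualPinnedText` — the VL child text.

Proofs only; no definition.  References: BGM 2006 §2.4 (2.38).
-/

noncomputable section

namespace Summit.HubbardSuperconductivity.HubbardSuperconductivity.Theorems.TwoVolumeDefect

set_option linter.dupNamespace false -- summit = problem name (single-conjunct summit), D-0017

open Finset Filter Topology Complex Literature.MathematicalPhysics.QuantumLattice Literature.Probability.LatticeModels GrassmannAlgebra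
open Summit.HubbardSuperconductivity.HubbardSuperconductivity.Theorems.KLRegimeSplit
open Summit.HubbardSuperconductivity.HubbardSuperconductivity.Theorems.KLProgrammeLegKernels

/-! ## §1 Rows ≤ pinned kernels: drop the phases, sum the times -/

section Rows

variable {Lc Lf M : ℕ} [NeZero Lc] [NeZero Lf]

omit [NeZero Lc] [NeZero Lf] in
/-- A phase-weighted time row is bounded by the plain time sum of the kernel norms (`|e^{iθ}| = 1`). [folklore] -/
theorem norm_phaseRow_le {L : ℕ} [NeZero L] (W : (Fin 2 → SpaceTimeIdx L M) → ℂ) (β : ℝ) (n : MatsubaraIdx M) (o : SpaceTimeIdx L M)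
    (x : TorusSite 2 L) :
    ‖∑ t₁ : ImagTimeIdx M, W ![o, (t₁, x)] * Complex.exp (((matsubaraFreq β M n * (imagTime β M o.1 - imagTime β M t₁) : ℝ) : ℂ) * I)‖ ≤
      ∑ t₁ : ImagTimeIdx M, ‖W ![o, (t₁, x)]‖ := by
  refine (norm_sum_le _ _).trans (sum_le_sum fun t₁ _ => ?_)
  rw [norm_mul, Complex.norm_exp_ofReal_mul_I, mul_one]

omit [NeZero Lc] [NeZero Lf] in
/-- A difference of two phase-weighted time rows with the SAME base time is bounded by the time sum of the kernel differences. [folklore] -/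
theorem norm_phaseRow_sub_le (Wc : (Fin 2 → SpaceTimeIdx Lc M) → ℂ) (Wf : (Fin 2 → SpaceTimeIdx Lf M) → ℂ) (β : ℝ) (n : MatsubaraIdx M)
    (oc : SpaceTimeIdx Lc M) (of : SpaceTimeIdx Lf M) (ht : of.1 = oc.1) (x : TorusSite 2 Lc) (x' : TorusSite 2 Lf) :
    ‖(∑ t₁ : ImagTimeIdx M, Wc ![oc, (t₁, x)] * Complex.exp (((matsubaraFreq β M n * (imagTime β M oc.1 - imagTime β M t₁) : ℝ) : ℂ) * I)) -
        ∑ t₁ : ImagTimeIdx M, Wf ![of, (t₁, x')] * Complex.exp (((matsubaraFreq β M n * (imagTime β M of.1 - imagTime β M t₁) : ℝ) : ℂ) * I)‖ ≤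
      ∑ t₁ : ImagTimeIdx M, ‖Wc ![oc, (t₁, x)] - Wf ![of, (t₁, x')]‖ := by
  rw [ht, ← sum_sub_distrib]
  refine (norm_sum_le _ _).trans (sum_le_sum fun t₁ _ => ?_)
  rw [← sub_mul, norm_mul, Complex.norm_exp_ofReal_mul_I, mul_one]

/-- **DUAL ROWS ≤ PINNED TWO-LEG DEFECT** (pins with a common time coordinate): `Ddef₊ + Dfar₊ ≤ PDef + PFar`.  See the module docstring.
[cite: BenfattoGiulianiMastropietro2006, §2.4 (2.38)] -/
theorem dualRows_le_pinnedDefect (Wc : (Fin 2 → SpaceTimeIdx Lc M) → ℂ) (Wf : (Fin 2 → SpaceTimeIdx Lf M) → ℂ) (β : ℝ) (n : MatsubaraIdx M)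
    (oc : SpaceTimeIdx Lc M) (of : SpaceTimeIdx Lf M) (ht : of.1 = oc.1) :
    (∑ ybar : TorusSite 2 Lc,
        ‖(∑ t₁ : ImagTimeIdx M, Wc ![oc, (t₁, oc.2 + ybar)] *
              Complex.exp (((matsubaraFreq β M n * (imagTime β M oc.1 - imagTime β M t₁) : ℝ) : ℂ) * I)) -
          ∑ t₁ : ImagTimeIdx M, Wf ![of, (t₁, of.2 + Torus.proj Lf (Torus.cRep ybar))] *
              Complex.exp (((matsubaraFreq β M n * (imagTime β M of.1 - imagTime β M t₁) : ℝ) : ℂ) * I)‖) +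
      ∑ y ∈ univ.filter (fun y : TorusSite 2 Lf => Torus.proj Lf (Torus.cRep (fun i => (((y i).val : ℕ) : ZMod Lc))) ≠ y),
        ‖∑ t₁ : ImagTimeIdx M, Wf ![of, (t₁, of.2 + y)] *
            Complex.exp (((matsubaraFreq β M n * (imagTime β M of.1 - imagTime β M t₁) : ℝ) : ℂ) * I)‖ ≤
      (∑ t₁ : ImagTimeIdx M, ∑ ybar : TorusSite 2 Lc, ‖Wc ![oc, (t₁, oc.2 + ybar)] - Wf ![of, (t₁, of.2 + Torus.proj Lf (Torus.cRep ybar))]‖) +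
        ∑ t₁ : ImagTimeIdx M, ∑ y ∈ univ.filter (fun y : TorusSite 2 Lf => Torus.proj Lf (Torus.cRep (fun i => (((y i).val : ℕ) : ZMod Lc))) ≠ y),
          ‖Wf ![of, (t₁, of.2 + y)]‖ := by
  refine add_le_add ?_ ?_
  · rw [sum_comm]
    exact sum_le_sum fun ybar _ => norm_phaseRow_sub_le Wc Wf β n oc of ht _ _
  · rw [sum_comm]
    exact sum_le_sum fun y _ => norm_phaseRow_le Wf β n of _

end Rows

end Summit.HubbardSuperconductivity.HubbardSuperconductivity.Theorems.TwoVolumeDefect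

/-! ## §2 The VL stub text from the pinned position-space two-leg defect at the last scale -/

namespace Summit.HubbardSuperconductivity.HubbardSuperconductivity.Theorems.TwoPointAssembly

set_option linter.dupNamespace false -- summit = problem name (single-conjunct summit), D-0017

open Finset Filter Topology Complex Literature.MathematicalPhysics.QuantumLattice Literature.Probability.LatticeModels GrassmannAlgebra
open Summit.HubbardSuperconductivity.HubbardSuperconductivity.Theorems.KLRegimeSplit
open Summit.HubbardSuperconductivity.HubbardSuperconductivity.Theorems.KLProgrammeLegKernels
open Summit.HubbardSuperconductivity.HubbardSuperconductivity.Theorems.TwoVolumeDefect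

/-- **THE STUB TEXT OF «cauchy v8-F2» FROM THE PINNED POSITION-SPACE TWO-LEG DEFECT AT THE LAST SCALE** (pins with a common time coordinate; second legs
matched through the centred lift of the offset; times summed; no phases): `W_V = sectorisedKernel V M β (trivialMultiplier V M) G_V 2 ((0,0,+),(0,0,−))`,
`G_V = 𝒱_V[K_V] − 𝒩_{K_V}` at `(K_V, n) = (klFlowFrameU V M β U μ (n_β+1), n_β+1)`. [cite: BenfattoGiulianiMastropietro2006, §2.4 (2.38)] -/
theorem framedNestedFlowTextV17F2_of_lastScaleDualPinnedText
    (hD : ∀ (G : GeoConsts) (P : SplitConsts) (Q : EngConsts) (R : RenConsts), G.WF → P.WF → Q.WF → R.WF →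
      ∃ c₅ : ℝ, 0 < c₅ ∧ ∀ c : ℝ, 0 < c → c ≤ c₅ → ∃ U₀ : ℝ, 0 < U₀ ∧
        ∀ μ ∈ klWindowC, ∀ U : ℝ, 0 < U → U ≤ U₀ → ∀ β : ℝ, klBetaMin ≤ β → β ≤ Real.exp (c / U ^ 2) →
          ∀ K : TrigPolyC4v, klPredsV17F2.frameOK R U (nScales β) μ K →
            ∀ (Lstar : ℕ) (Mstar : ℕ → ℕ), TowerP klPredsV17F2 G P Q R β U μ K Lstar Mstar →
              ∀ n : ℤ, ∃ L₀ : ℕ, ∃ δ : ℕ → ℝ, Tendsto δ atTop (𝓝 0) ∧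
                ∀ (L : ℕ) [NeZero L], L₀ ≤ L → ∀ (L'' : ℕ) [NeZero L''] (b : ℕ), L'' = b * L → ∃ M₀ : ℕ, ∀ (M : ℕ) [NeZero M], M₀ ≤ M →
                  ∃ (oc : SpaceTimeIdx L M) (of : SpaceTimeIdx L'' M), of.1 = oc.1 ∧ ∀ ω : MatsubaraIdx M, matsubaraInt M ω = n →
                    2 * imagTimeWeight β M *
                      ((∑ t₁ : ImagTimeIdx M, ∑ ybar : TorusSite 2 L,
                          ‖sectorisedKernel L M β (trivialMultiplier L M)
                                (klEffectiveAction L M β U μ (klFlowFrameU L M β U μ (nScales β + 1)) klE0 (nScales β + 1) -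
                                  counterQuadratic L M β (klFlowFrameU L M β U μ (nScales β + 1))) 2
                                (![((0, 0), 0), ((0, 0), 1)] : Fin 2 → SectorLeg 1) ![oc, (t₁, oc.2 + ybar)] -
                            sectorisedKernel L'' M β (trivialMultiplier L'' M)
                                (klEffectiveAction L'' M β U μ (klFlowFrameU L'' M β U μ (nScales β + 1)) klE0 (nScales β + 1) -
                                  counterQuadratic L'' M β (klFlowFrameU L'' M β U μ (nScales β + 1))) 2
                                (![((0, 0), 0), ((0, 0), 1)] : Fin 2 → SectorLeg 1) ![of, (t₁, of.2 + Torus.proj L'' (Torus.cRep ybar))]‖) +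
                        ∑ t₁ : ImagTimeIdx M,
                          ∑ y ∈ univ.filter (fun y : TorusSite 2 L'' => Torus.proj L'' (Torus.cRep (fun i => (((y i).val : ℕ) : ZMod L))) ≠ y),
                            ‖sectorisedKernel L'' M β (trivialMultiplier L'' M)
                                (klEffectiveAction L'' M β U μ (klFlowFrameU L'' M β U μ (nScales β + 1)) klE0 (nScales β + 1) -
                                  counterQuadratic L'' M β (klFlowFrameU L'' M β U μ (nScales β + 1))) 2
                                (![((0, 0), 0), ((0, 0), 1)] : Fin 2 → SectorLeg 1) ![of, (t₁, of.2 + y)]‖) ≤ δ L) :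
    ∀ (G : GeoConsts) (P : SplitConsts) (Q : EngConsts) (R : RenConsts), G.WF → P.WF → Q.WF → R.WF →
      ∃ c₅ : ℝ, 0 < c₅ ∧ ∀ c : ℝ, 0 < c → c ≤ c₅ → ∃ U₀ : ℝ, 0 < U₀ ∧
        ∀ μ ∈ klWindowC, ∀ U : ℝ, 0 < U → U ≤ U₀ → ∀ β : ℝ, klBetaMin ≤ β → β ≤ Real.exp (c / U ^ 2) →
          ∀ K : TrigPolyC4v, klPredsV17F2.frameOK R U (nScales β) μ K →
            ∀ (Lstar : ℕ) (Mstar : ℕ → ℕ), TowerP klPredsV17F2 G P Q R β U μ K Lstar Mstar →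
              ∀ n : ℤ, ∃ L₀ : ℕ, ∃ ρ : ℕ → ℝ, Tendsto ρ atTop (𝓝 0) ∧
                ∀ (L : ℕ) [NeZero L], L₀ ≤ L → ∀ (L'' : ℕ) [NeZero L''], L ∣ L'' → ∃ M₀ : ℕ, ∀ (M : ℕ) [NeZero M], M₀ ≤ M →
                  ∀ (ω : MatsubaraIdx M), matsubaraInt M ω = n → ∀ (k : TorusSite 2 L) (k'' : TorusSite 2 L''),
                    latticeMomentum L'' k'' = latticeMomentum L k →
                      ‖klSelfEnergy L M β U μ (klFlowFrameU L M β U μ (nScales β + 1)) klE0 (nScales β + 1) (ω, k) 0 -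
                          klSelfEnergy L'' M β U μ (klFlowFrameU L'' M β U μ (nScales β + 1)) klE0 (nScales β + 1) (ω, k'') 0‖ ≤ ρ L := by
  refine framedNestedFlowTextV17F2_of_lastScaleDualDefectText ?_
  intro G P Q R hG hP hQ hR
  obtain ⟨c₅, hc₅, hc⟩ := hD G P Q R hG hP hQ hR
  refine ⟨c₅, hc₅, fun c hc0 hcc => ?_⟩
  obtain ⟨U₀, hU₀, hU⟩ := hc c hc0 hcc
  refine ⟨U₀, hU₀, fun μ hμ U hU0 hUU β hβmin hβmax K hK Lstar Mstar hT n => ?_⟩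
  have hβ : 0 < β := pos_of_klBetaMin_le hβmin
  obtain ⟨L₀, δ, hδ, hDn⟩ := hU μ hμ U hU0 hUU β hβmin hβmax K hK Lstar Mstar hT n
  refine ⟨L₀, δ, hδ, fun L _ hL L'' _ b hb => ?_⟩
  obtain ⟨M₀, hM₀⟩ := hDn L hL L'' b hb
  refine ⟨M₀, fun M _ hM => ?_⟩
  obtain ⟨oc, of, ht, hw⟩ := hM₀ M hM
  refine ⟨oc, of, fun ω hω => ?_⟩
  have hε : 0 ≤ 2 * imagTimeWeight β M := by have := imagTimeWeight_nonneg hβ.le M; positivity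
  exact (mul_le_mul_of_nonneg_left (dualRows_le_pinnedDefect _ _ β ω oc of ht) hε).trans (hw ω hω)

/-- **The VL child text from the pinned position-space two-leg defect at the last scale** (∘ `volumeLimitTextV17F2_of_framedNestedFlowText`).
[cite: BenfattoGiulianiMastropietro2006, §2.4 (2.38)] -/
theorem volumeLimitTextV17F2_of_lastScaleDualPinnedText
    (hD : ∀ (G : GeoConsts) (P : SplitConsts) (Q : EngConsts) (R : RenConsts), G.WF → P.WF → Q.WF → R.WF →
      ∃ c₅ : ℝ, 0 < c₅ ∧ ∀ c : ℝ, 0 < c → c ≤ c₅ → ∃ U₀ : ℝ, 0 < U₀ ∧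
        ∀ μ ∈ klWindowC, ∀ U : ℝ, 0 < U → U ≤ U₀ → ∀ β : ℝ, klBetaMin ≤ β → β ≤ Real.exp (c / U ^ 2) →
          ∀ K : TrigPolyC4v, klPredsV17F2.frameOK R U (nScales β) μ K →
            ∀ (Lstar : ℕ) (Mstar : ℕ → ℕ), TowerP klPredsV17F2 G P Q R β U μ K Lstar Mstar →
              ∀ n : ℤ, ∃ L₀ : ℕ, ∃ δ : ℕ → ℝ, Tendsto δ atTop (𝓝 0) ∧
                ∀ (L : ℕ) [NeZero L], L₀ ≤ L → ∀ (L'' : ℕ) [NeZero L''] (b : ℕ), L'' = b * L → ∃ M₀ : ℕ, ∀ (M : ℕ) [NeZero M], M₀ ≤ M →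
                  ∃ (oc : SpaceTimeIdx L M) (of : SpaceTimeIdx L'' M), of.1 = oc.1 ∧ ∀ ω : MatsubaraIdx M, matsubaraInt M ω = n →
                    2 * imagTimeWeight β M *
                      ((∑ t₁ : ImagTimeIdx M, ∑ ybar : TorusSite 2 L,
                          ‖sectorisedKernel L M β (trivialMultiplier L M)
                                (klEffectiveAction L M β U μ (klFlowFrameU L M β U μ (nScales β + 1)) klE0 (nScales β + 1) -
                                  counterQuadratic L M β (klFlowFrameU L M β U μ (nScales β + 1))) 2
                                (![((0, 0), 0), ((0, 0), 1)] : Fin 2 → SectorLeg 1) ![oc, (t₁, oc.2 + ybar)] -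
                            sectorisedKernel L'' M β (trivialMultiplier L'' M)
                                (klEffectiveAction L'' M β U μ (klFlowFrameU L'' M β U μ (nScales β + 1)) klE0 (nScales β + 1) -
                                  counterQuadratic L'' M β (klFlowFrameU L'' M β U μ (nScales β + 1))) 2
                                (![((0, 0), 0), ((0, 0), 1)] : Fin 2 → SectorLeg 1) ![of, (t₁, of.2 + Torus.proj L'' (Torus.cRep ybar))]‖) +
                        ∑ t₁ : ImagTimeIdx M,
                          ∑ y ∈ univ.filter (fun y : TorusSite 2 L'' => Torus.proj L'' (Torus.cRep (fun i => (((y i).val : ℕ) : ZMod L))) ≠ y),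
                            ‖sectorisedKernel L'' M β (trivialMultiplier L'' M)
                                (klEffectiveAction L'' M β U μ (klFlowFrameU L'' M β U μ (nScales β + 1)) klE0 (nScales β + 1) -
                                  counterQuadratic L'' M β (klFlowFrameU L'' M β U μ (nScales β + 1))) 2
                                (![((0, 0), 0), ((0, 0), 1)] : Fin 2 → SectorLeg 1) ![of, (t₁, of.2 + y)]‖) ≤ δ L) :
    VolumeLimitP2 klPredsV17F2 FinalTwoLegVolLimitEx klWindowC :=
  volumeLimitTextV17F2_of_framedNestedFlowText (framedNestedFlowTextV17F2_of_lastScaleDualPinnedText hD)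

end Summit.HubbardSuperconductivity.HubbardSuperconductivity.Theorems.TwoPointAssembly
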